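import Summits.SmoothPoincare4.SmoothPoincare4.Theses.EntropyRung
import Literature.Geometry.Riemannian.RoundSphereProofs
import Literature.Geometry.Riemannian.AubinYamabeSphereEuclidean
import Literature.Geometry.Riemannian.ChangGurskyYangProofs
import Literature.Geometry.Lorentzian.DalembertianCompose
import HarnessLib

/-!
# The Green function `2/(1 − ⟪x,p⟫)` of the conformal Laplacian of the round `S⁴`
(stub `helper_sphereGreenRound`, witness helper 5 of line `green-blowup-conformal-entropy`, crux
`EntropyRung.SubcylindricalExistence`, item stmt-SmoothPoincare4-10871)

On the round unit sphere `S⁴ = Metric.sphere (0 : EuclideanSpace ℝ (Fin 5)) 1` (metric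
`roundMetric`, `R = 12` by `scalarCurvature_roundMetric`) fix a pole `p` and the height function
`h(x) = ⟪x, p⟫`. GIVEN the height package (`h` smooth, `|∇h|² = 1 − h²`, `Δh = −4h`, received as a
hypothesis), the function `G_S(x) = 2/(1 − h(x))` (`= 1/sin²(d(x,p)/2)`) is

* smooth on `{p}ᶜ` and positive off `p` (`h < 1` off `p`: equality case of Cauchy–Schwarz on the
  unit sphere);
* a solution of `R G_S − 6 Δ G_S = 0` off `p` — the chain rule
  `Δ(ζ ∘ h) = ζ''(h)|∇h|² + ζ'(h) Δh` (`dalembertian_real_comp`) with `ζ(t) = 2/(1 − t)`,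
  `ζ' = 2/(1 − t)²`, `ζ'' = 4/(1 − t)³`:
  `12 ζ − 6 [ζ''(1 − h²) − 4h ζ'] = 24/(1 − h) − 24(1 − h)/(1 − h)² = 0`;
* `G_S → +∞` along `𝓝[≠] p` (`1 − h → 0⁺`);
* `|∇G_S|² = ζ'(h)² |∇h|² = 4(1 + h)/(1 − h)³ = G_S² (G_S − 1)` (`mvfderiv_real_comp` and
  bilinearity of the inverse metric `innerDual`).

That is, `G_S` is (a constant multiple of) the Green function at `p` of the conformal Laplacian
`−6Δ + R` of the round `S⁴` (Lee–Parker 1987, §2–§3: `a = 4(n−1)/(n−2) = 6`, and under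
stereographic projection from `p` the metric `G_S² g_S` is flat). Everything is proved; no
definition, no named fact.

References: J. M. Lee, T. H. Parker, *The Yamabe problem*, Bull. AMS 17 (1987), §2–§3
[LeeParker1987]; B. O'Neill, *Semi-Riemannian geometry* (1983), Ch. 3, Def. 3.50 [ONeill1983].
-/

noncomputable section

-- the registered namespace `Summit.SmoothPoincare4.SmoothPoincare4.Theorems` repeats a component
set_option linter.dupNamespace false

open scoped Manifold ContDiff Topology ENNReal NNReal ContinuousMap RealInnerProductSpace
open Set Filter MeasureTheory
open Literature.Geometry.Lorentzian Literature.Geometry.Riemannian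

namespace Summit.SmoothPoincare4.SmoothPoincare4.Theorems

namespace SphereGreenRound

/-! ### The profile `ζ(t) = 2/(1 − t)` -/

/-- `ζ'(t) = 2/(1 − t)²` away from `t = 1`. [folklore] -/
theorem hasDerivAt_profile {t : ℝ} (ht : 1 - t ≠ 0) :
    HasDerivAt (fun t : ℝ ↦ 2 / (1 - t)) (2 / (1 - t) ^ 2) t := by
  refine ((hasDerivAt_const t 2).fun_div ((hasDerivAt_id' t).const_sub 1) ht).congr_deriv ?_
  ring

/-- `ζ'(t) = 2/(1 − t)²` away from `t = 1` (`deriv` form). [folklore] -/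
theorem deriv_profile {t : ℝ} (ht : 1 - t ≠ 0) :
    deriv (fun t : ℝ ↦ 2 / (1 - t)) t = 2 / (1 - t) ^ 2 :=
  (hasDerivAt_profile ht).deriv

/-- `ζ''(t) = 4/(1 − t)³` away from `t = 1`. [folklore] -/
theorem deriv_deriv_profile {t : ℝ} (ht : 1 - t ≠ 0) :
    deriv (deriv (fun t : ℝ ↦ 2 / (1 - t))) t = 4 / (1 - t) ^ 3 := by
  have ht' : t ≠ 1 := fun h ↦ ht (by rw [h, sub_self])
  have hev : deriv (fun t : ℝ ↦ 2 / (1 - t)) =ᶠ[𝓝 t] fun t ↦ 2 / (1 - t) ^ 2 := by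
    filter_upwards [compl_singleton_mem_nhds ht'] with s hs
    exact deriv_profile (sub_ne_zero.2 (Ne.symm (Set.mem_compl_singleton_iff.1 hs)))
  rw [hev.deriv_eq]
  refine (((hasDerivAt_const t 2).fun_div (((hasDerivAt_id' t).const_sub 1).fun_pow 2)
    (pow_ne_zero 2 ht)).congr_deriv ?_).deriv
  field_simp
  ring

/-- `ζ` is smooth away from `t = 1`. [folklore] -/
theorem contDiffAt_profile {n : WithTop ℕ∞} {t : ℝ} (ht : 1 - t ≠ 0) :
    ContDiffAt ℝ n (fun t : ℝ ↦ 2 / (1 - t)) t :=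
  contDiffAt_const.div (contDiffAt_const.sub contDiffAt_id) ht

/-! ### The height `⟪x, p⟫` on the unit sphere -/

section Height

variable {V : Type*} [NormedAddCommGroup V] [InnerProductSpace ℝ V]

/-- On the unit sphere `⟪p, p⟫ = 1`. [folklore] -/
theorem inner_self_sphere (p : Metric.sphere (0 : V) 1) : ⟪(p : V), (p : V)⟫ = 1 := by
  rw [real_inner_self_eq_norm_sq, norm_eq_of_mem_sphere, one_pow]

/-- On the unit sphere `⟪x, p⟫ < 1` for `x ≠ p` (equality case of Cauchy–Schwarz). [folklore] -/
theorem inner_lt_one_of_ne {x p : Metric.sphere (0 : V) 1} (hx : x ≠ p) :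
    ⟪(x : V), (p : V)⟫ < 1 := by
  refine lt_of_le_of_ne (real_inner_le_one_of_norm_eq_one (norm_eq_of_mem_sphere x)
    (norm_eq_of_mem_sphere p)) fun h ↦ hx (Subtype.ext ?_)
  exact (inner_eq_one_iff_of_norm_eq_one (𝕜 := ℝ) (norm_eq_of_mem_sphere x)
    (norm_eq_of_mem_sphere p)).1 h

/-- Hence `1 − ⟪x, p⟫ ≠ 0` for `x ≠ p` on the unit sphere. [folklore] -/
theorem one_sub_inner_ne_zero {x p : Metric.sphere (0 : V) 1} (hx : x ≠ p) :
    1 - ⟪(x : V), (p : V)⟫ ≠ 0 :=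
  (sub_pos.2 (inner_lt_one_of_ne hx)).ne'

/-- **Positivity**: `0 < 2/(1 − ⟪x, p⟫)` for `x ≠ p` on the unit sphere. [folklore] -/
theorem green_pos {x p : Metric.sphere (0 : V) 1} (hx : x ≠ p) :
    0 < 2 / (1 - ⟪(x : V), (p : V)⟫) :=
  div_pos two_pos (sub_pos.2 (inner_lt_one_of_ne hx))

end Height

/-! ### The Green function `2/(1 − ⟪x, p⟫)` on the round `S⁴` -/

section Round

variable {V : Type*} [NormedAddCommGroup V] [InnerProductSpace ℝ V]
  [Fact (Module.finrank ℝ V = 4 + 1)]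

/-- **Smoothness off the pole**: `x ↦ 2/(1 − ⟪x, p⟫)` is `C^∞` on `{p}ᶜ` (composition of the
smooth height with `ζ`, smooth away from `1`). [folklore] -/
theorem contMDiffOn_green (p : Metric.sphere (0 : V) 1)
    (hsm : ContMDiff (𝓡 4) 𝓘(ℝ, ℝ) ∞ (fun x : Metric.sphere (0 : V) 1 ↦ ⟪(x : V), (p : V)⟫)) :
    ContMDiffOn (𝓡 4) 𝓘(ℝ, ℝ) ∞
      (fun x : Metric.sphere (0 : V) 1 ↦ 2 / (1 - ⟪(x : V), (p : V)⟫)) {p}ᶜ := by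
  intro x hx
  have hx' : x ≠ p := fun h ↦ hx (Set.mem_singleton_iff.2 h)
  exact ((contDiffAt_profile (one_sub_inner_ne_zero hx')).comp_contMDiffAt
    (f := fun x : Metric.sphere (0 : V) 1 ↦ ⟪(x : V), (p : V)⟫) (x := x) (hsm x)).contMDiffWithinAt

/-- **Blow-up at the pole**: `2/(1 − ⟪x, p⟫) → +∞` as `x → p`, `x ≠ p` (`1 − ⟪x, p⟫ → 0⁺`).
[folklore] -/
theorem tendsto_green (p : Metric.sphere (0 : V) 1)
    (hsm : ContMDiff (𝓡 4) 𝓘(ℝ, ℝ) ∞ (fun x : Metric.sphere (0 : V) 1 ↦ ⟪(x : V), (p : V)⟫)) :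
    Tendsto (fun x : Metric.sphere (0 : V) 1 ↦ 2 / (1 - ⟪(x : V), (p : V)⟫)) (𝓝[≠] p) atTop := by
  have hc : Continuous (fun x : Metric.sphere (0 : V) 1 ↦ ⟪(x : V), (p : V)⟫) := hsm.continuous
  have h1 : Tendsto (fun x : Metric.sphere (0 : V) 1 ↦ 1 - ⟪(x : V), (p : V)⟫) (𝓝[≠] p)
      (𝓝[>] 0) := by
    refine tendsto_nhdsWithin_iff.2 ⟨?_, ?_⟩
    · have h : Tendsto (fun x : Metric.sphere (0 : V) 1 ↦ (1 : ℝ) - ⟪(x : V), (p : V)⟫) (𝓝 p)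
          (𝓝 ((1 : ℝ) - ⟪(p : V), (p : V)⟫)) := (continuous_const.sub hc).tendsto p
      rw [inner_self_sphere, sub_self] at h
      exact h.mono_left nhdsWithin_le_nhds
    · filter_upwards [self_mem_nhdsWithin] with x hx
      exact sub_pos.2 (inner_lt_one_of_ne fun h ↦ hx (Set.mem_singleton_iff.2 h))
  refine ((tendsto_inv_nhdsGT_zero.comp h1).const_mul_atTop two_pos).congr fun x ↦ ?_
  rw [Function.comp_apply, div_eq_mul_inv]

/-- **The Green equation** `R G_S − 6 Δ G_S = 0` off the pole for `G_S = 2/(1 − h)`, from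
`R = 12`, `|∇h|² = 1 − h²`, `Δh = −4h` and the chain rule `Δ(ζ ∘ h) = ζ''(h)|∇h|² + ζ'(h)Δh`.
[cite: LeeParker1987, §2–§3] -/
theorem conformalLaplacian_green [(roundMetric (n := 4) V).HasLeviCivita]
    (p : Metric.sphere (0 : V) 1)
    (hsm : ContMDiff (𝓡 4) 𝓘(ℝ, ℝ) ∞ (fun x : Metric.sphere (0 : V) 1 ↦ ⟪(x : V), (p : V)⟫))
    (hgrad : ∀ x : Metric.sphere (0 : V) 1, (roundMetric (n := 4) V).gradSq
      (fun x : Metric.sphere (0 : V) 1 ↦ ⟪(x : V), (p : V)⟫) x = 1 - ⟪(x : V), (p : V)⟫ ^ 2)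
    (hbox : ∀ x : Metric.sphere (0 : V) 1, (roundMetric (n := 4) V).dalembertian
      (fun x : Metric.sphere (0 : V) 1 ↦ ⟪(x : V), (p : V)⟫) x = -4 * ⟪(x : V), (p : V)⟫)
    {x : Metric.sphere (0 : V) 1} (hx : x ≠ p) :
    (roundMetric (n := 4) V).scalarCurvature x * (2 / (1 - ⟪(x : V), (p : V)⟫)) -
      6 * (roundMetric (n := 4) V).dalembertian
        (fun x : Metric.sphere (0 : V) 1 ↦ 2 / (1 - ⟪(x : V), (p : V)⟫)) x = 0 := by
  have h1 : 1 - ⟪(x : V), (p : V)⟫ ≠ 0 := one_sub_inner_ne_zero hx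
  have h2 : ContMDiffAt (𝓡 4) 𝓘(ℝ, ℝ) 2 (fun x : Metric.sphere (0 : V) 1 ↦ ⟪(x : V), (p : V)⟫) x :=
    (hsm x).of_le (WithTop.coe_le_coe.mpr le_top)
  have hR : (roundMetric (n := 4) V).scalarCurvature x = 12 := by
    rw [scalarCurvature_roundMetric (m := 4) V x]
    norm_num
  have hcomp : (fun x : Metric.sphere (0 : V) 1 ↦ 2 / (1 - ⟪(x : V), (p : V)⟫)) =
      (fun t : ℝ ↦ 2 / (1 - t)) ∘ (fun x : Metric.sphere (0 : V) 1 ↦ ⟪(x : V), (p : V)⟫) := rfl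
  have hgs : (roundMetric (n := 4) V).innerDual x
      (mvfderiv (𝓡 4) (fun x : Metric.sphere (0 : V) 1 ↦ ⟪(x : V), (p : V)⟫) x).toLinearMap
      (mvfderiv (𝓡 4) (fun x : Metric.sphere (0 : V) 1 ↦ ⟪(x : V), (p : V)⟫) x).toLinearMap =
      (roundMetric (n := 4) V).gradSq (fun x : Metric.sphere (0 : V) 1 ↦ ⟪(x : V), (p : V)⟫) x :=
    rfl
  rw [hcomp, (roundMetric (n := 4) V).dalembertian_real_comp h2 (contDiffAt_profile h1), hgs,
    hgrad x, hbox x, deriv_profile h1, deriv_deriv_profile h1, hR]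
  field_simp
  ring

/-- **The gradient of the Green function**: `|∇G_S|² = G_S² (G_S − 1)` off the pole
(`d(ζ ∘ h) = ζ'(h) dh`, `|∇h|² = 1 − h²`, `ζ'(h)² (1 − h²) = 4(1 + h)/(1 − h)³`). [folklore] -/
theorem gradSq_green (p : Metric.sphere (0 : V) 1)
    (hsm : ContMDiff (𝓡 4) 𝓘(ℝ, ℝ) ∞ (fun x : Metric.sphere (0 : V) 1 ↦ ⟪(x : V), (p : V)⟫))
    (hgrad : ∀ x : Metric.sphere (0 : V) 1, (roundMetric (n := 4) V).gradSq
      (fun x : Metric.sphere (0 : V) 1 ↦ ⟪(x : V), (p : V)⟫) x = 1 - ⟪(x : V), (p : V)⟫ ^ 2)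
    {x : Metric.sphere (0 : V) 1} (hx : x ≠ p) :
    (roundMetric (n := 4) V).gradSq
        (fun x : Metric.sphere (0 : V) 1 ↦ 2 / (1 - ⟪(x : V), (p : V)⟫)) x =
      (2 / (1 - ⟪(x : V), (p : V)⟫)) ^ 2 * (2 / (1 - ⟪(x : V), (p : V)⟫) - 1) := by
  have h1 : 1 - ⟪(x : V), (p : V)⟫ ≠ 0 := one_sub_inner_ne_zero hx
  have hd : DifferentiableAt ℝ (fun t : ℝ ↦ 2 / (1 - t)) ⟪(x : V), (p : V)⟫ :=
    (hasDerivAt_profile h1).differentiableAt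
  have hmd : MDifferentiableAt (𝓡 4) 𝓘(ℝ, ℝ)
      (fun x : Metric.sphere (0 : V) 1 ↦ ⟪(x : V), (p : V)⟫) x :=
    (hsm x).mdifferentiableAt (by simp)
  have hcomp : (fun x : Metric.sphere (0 : V) 1 ↦ 2 / (1 - ⟪(x : V), (p : V)⟫)) =
      (fun t : ℝ ↦ 2 / (1 - t)) ∘ (fun x : Metric.sphere (0 : V) 1 ↦ ⟪(x : V), (p : V)⟫) := rfl
  have hD : mvfderiv (𝓡 4)
      ((fun t : ℝ ↦ 2 / (1 - t)) ∘ (fun x : Metric.sphere (0 : V) 1 ↦ ⟪(x : V), (p : V)⟫)) x =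
      deriv (fun t : ℝ ↦ 2 / (1 - t)) ⟪(x : V), (p : V)⟫ •
        mvfderiv (𝓡 4) (fun x : Metric.sphere (0 : V) 1 ↦ ⟪(x : V), (p : V)⟫) x := by
    ext v
    exact PseudoRiemannianMetric.mvfderiv_real_comp
      (u := fun x : Metric.sphere (0 : V) 1 ↦ ⟪(x : V), (p : V)⟫) (x := x) hd hmd v
  have key : (roundMetric (n := 4) V).gradSq
      ((fun t : ℝ ↦ 2 / (1 - t)) ∘ (fun x : Metric.sphere (0 : V) 1 ↦ ⟪(x : V), (p : V)⟫)) x =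
      deriv (fun t : ℝ ↦ 2 / (1 - t)) ⟪(x : V), (p : V)⟫ ^ 2 *
        (roundMetric (n := 4) V).gradSq
          (fun x : Metric.sphere (0 : V) 1 ↦ ⟪(x : V), (p : V)⟫) x := by
    simp only [PseudoRiemannianMetric.gradSq, hD, ContinuousLinearMap.toLinearMap_smul,
      PseudoRiemannianMetric.innerDual, map_smul, LinearMap.smul_apply, smul_eq_mul]
    ring
  rw [hcomp, key, hgrad x, deriv_profile h1]
  field_simp
  ring

end Round

end SphereGreenRound

/-- **Witness helper 5 of line `green-blowup-conformal-entropy`: the Green function of the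
conformal Laplacian of the round `S⁴`.** Given the height package on the round unit sphere
`S⁴ ⊂ ℝ⁵` (`h = ⟪·, p⟫` smooth, `|∇h|² = 1 − h²`, `Δh = −4h`), the function
`G_S(x) = 2/(1 − ⟪x, p⟫)` is smooth on `{p}ᶜ`, positive off `p`, solves `R G_S − 6 Δ G_S = 0` off
`p` (`R = 12`), tends to `+∞` at `p`, and has `|∇G_S|² = G_S² (G_S − 1)` off `p`.
[cite: LeeParker1987, §2–§3] -/
theorem helper_sphereGreenRound :
    (∀ [Fact (Module.finrank ℝ (EuclideanSpace ℝ (Fin 5)) = 4 + 1)] (p : Metric.sphere (0 :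
      EuclideanSpace ℝ (Fin 5)) 1) [(@roundMetric (EuclideanSpace ℝ (Fin 5)) _ _ 4
      _).HasLeviCivita], ContMDiff (𝓡 4) 𝓘(ℝ, ℝ) ∞ (fun x : Metric.sphere (0 : EuclideanSpace ℝ (Fin
      5)) 1 ↦ ⟪(x : EuclideanSpace ℝ (Fin 5)), (p : EuclideanSpace ℝ (Fin 5))⟫) ∧ (∀ x :
      Metric.sphere (0 : EuclideanSpace ℝ (Fin 5)) 1, (@roundMetric (EuclideanSpace ℝ (Fin 5)) _ _ 4
      _).gradSq (fun x : Metric.sphere (0 : EuclideanSpace ℝ (Fin 5)) 1 ↦ ⟪(x : EuclideanSpace ℝ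
      (Fin 5)), (p : EuclideanSpace ℝ (Fin 5))⟫) x = 1 - ⟪(x : EuclideanSpace ℝ (Fin 5)), (p :
      EuclideanSpace ℝ (Fin 5))⟫ ^ 2) ∧ (∀ x : Metric.sphere (0 : EuclideanSpace ℝ (Fin 5)) 1,
      (@roundMetric (EuclideanSpace ℝ (Fin 5)) _ _ 4 _).dalembertian (fun x : Metric.sphere (0 :
      EuclideanSpace ℝ (Fin 5)) 1 ↦ ⟪(x : EuclideanSpace ℝ (Fin 5)), (p : EuclideanSpace ℝ (Fin
      5))⟫) x = -4 * ⟪(x : EuclideanSpace ℝ (Fin 5)), (p : EuclideanSpace ℝ (Fin 5))⟫)) → ∀ [Fact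
      (Module.finrank ℝ (EuclideanSpace ℝ (Fin 5)) = 4 + 1)] (p : Metric.sphere (0 : EuclideanSpace
      ℝ (Fin 5)) 1) [(@roundMetric (EuclideanSpace ℝ (Fin 5)) _ _ 4 _).HasLeviCivita], ContMDiffOn
      (𝓡 4) 𝓘(ℝ, ℝ) ∞ (fun x : Metric.sphere (0 : EuclideanSpace ℝ (Fin 5)) 1 ↦ (2 / (1 - ⟪(x :
      EuclideanSpace ℝ (Fin 5)), (p : EuclideanSpace ℝ (Fin 5))⟫))) {p}ᶜ ∧ (∀ x : Metric.sphere (0 :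
      EuclideanSpace ℝ (Fin 5)) 1, x ≠ p → 0 < (2 / (1 - ⟪(x : EuclideanSpace ℝ (Fin 5)), (p :
      EuclideanSpace ℝ (Fin 5))⟫))) ∧ (∀ x : Metric.sphere (0 : EuclideanSpace ℝ (Fin 5)) 1, x ≠ p →
      (@roundMetric (EuclideanSpace ℝ (Fin 5)) _ _ 4 _).scalarCurvature x * (2 / (1 - ⟪(x :
      EuclideanSpace ℝ (Fin 5)), (p : EuclideanSpace ℝ (Fin 5))⟫)) - 6 * (@roundMetric
      (EuclideanSpace ℝ (Fin 5)) _ _ 4 _).dalembertian (fun x : Metric.sphere (0 : EuclideanSpace ℝ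
      (Fin 5)) 1 ↦ (2 / (1 - ⟪(x : EuclideanSpace ℝ (Fin 5)), (p : EuclideanSpace ℝ (Fin 5))⟫))) x =
      0) ∧ Tendsto (fun x : Metric.sphere (0 : EuclideanSpace ℝ (Fin 5)) 1 ↦ (2 / (1 - ⟪(x :
      EuclideanSpace ℝ (Fin 5)), (p : EuclideanSpace ℝ (Fin 5))⟫))) (𝓝[≠] p) atTop ∧ (∀ x :
      Metric.sphere (0 : EuclideanSpace ℝ (Fin 5)) 1, x ≠ p → (@roundMetric (EuclideanSpace ℝ (Fin
      5)) _ _ 4 _).gradSq (fun x : Metric.sphere (0 : EuclideanSpace ℝ (Fin 5)) 1 ↦ (2 / (1 - ⟪(x :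
      EuclideanSpace ℝ (Fin 5)), (p : EuclideanSpace ℝ (Fin 5))⟫))) x = (2 / (1 - ⟪(x :
      EuclideanSpace ℝ (Fin 5)), (p : EuclideanSpace ℝ (Fin 5))⟫)) ^ 2 * ((2 / (1 - ⟪(x :
      EuclideanSpace ℝ (Fin 5)), (p : EuclideanSpace ℝ (Fin 5))⟫)) - 1)) := by
  intro H _ p _
  obtain ⟨hsm, hgrad, hbox⟩ := H p
  exact ⟨SphereGreenRound.contMDiffOn_green p hsm, fun x hx ↦ SphereGreenRound.green_pos hx,
    fun x hx ↦ SphereGreenRound.conformalLaplacian_green p hsm hgrad hbox hx,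
    SphereGreenRound.tendsto_green p hsm,
    fun x hx ↦ SphereGreenRound.gradSq_green p hsm hgrad hx⟩

end Summit.SmoothPoincare4.SmoothPoincare4.Theorems

end
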